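import Summits.CriticalPhenomena.PercolationContinuityZ3.Theorems.SahiMasterFamilyRemovalInjection

/-!
# RULE T, preliminaries: orbit surgery under the short-cut, hereditarily bad cycles, the encoder/decoder of RULE T

Unit `prim-masterthm-p4` (gen 25; crux anchor stmt-CriticalPhenomena-4575, helper work; memo
`run/shared/lean/prim/prim-masterthm/prim-masterthm-p4/P4-GEN25-REPORT.md` §1).  Second of three files (`…RemovalInjection` → this →
`…RuleT`).  Everything here is about ONE family `𝒰` of subsets of `Fin (n+1)` and the short-cut `cut y σ = swap y (σ y) * σ`.

RULE T (`enc 𝒰 σ S`, on a ground set `S` that is a union of cycles of `σ`; `M = max S`):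
 (a) `S ∉ 𝒰`: delete the successor `σ p` of the canonical UNCOVERED point `p = uncov 𝒰 S` of `S` (a point of `S` in no member of `𝒰` inside
     `S`; one exists when `𝒰` is union-closed, `exists_uncovIn`);
 (b) `S ∈ 𝒰`: if the cycle of `M` is HEREDITARILY BAD (`HB`: deleting the predecessor of `M` repeatedly, every intermediate cycle of `M` is a
     non-member — i.e. all proper prefix sets `{M, σM, …, σʲM}` of the cycle are non-members; vacuous when `M` is fixed) delete the
     predecessor `σ⁻¹ M` (`= M` when `M` is fixed); otherwise recurse on `S` minus the cycle of `M`.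
The DECODER `dec 𝒰 y σ′ S`: (a) re-insert `y` after `p`; (b) if `y = M`, or the cycle of `M` in `σ′` and all its prefixes are non-members,
re-insert `y` just before `M`; otherwise recurse on `S` minus the cycle of `M`.

CONTENTS: orbit surgery (`sameCycle_cut_apply`, `sameCycle_of_sameCycle_cut`, `orbit_cut_succ_base`, `orbit_cut_of_sameCycle`,
`orbit_cut_of_not_sameCycle'`, `sameCycle_cut_of_sameCycle'`, `orbit_subset_of_stable`, `stable_cut`, `cut_apply_of_not_sameCycle`,
`orbit_cut_pred`, `card_orbit_cut_pred`); `HBk`/`HB` with `HB_of_apply_eq`, `HB_iff_of_apply_ne` (one-step unfolding) and `HB_congr`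
(depends on `σ` only through the cycle of `M`); `UncovIn`/`uncov`/`exists_uncovIn`; `enc`/`dec` (well-founded on `#S`) and their
unfolding lemmas.  The theorem is in `…RuleT`.  Axioms standard. [this work]
-/

noncomputable section

open scoped Classical

namespace Summit.CriticalPhenomena.PercolationContinuityZ3.Theorems

namespace RemovalInjection

open Finset Function Equiv Equiv.Perm
open Literature.Combinatorics.Sahi2008.CycleForm

variable {n : ℕ}

/-- The short-cut only ever sends a point into the old cycle of that point. [this work] -/
theorem sameCycle_cut_apply (y : Fin (n + 1)) (σ : Perm (Fin (n + 1))) (z : Fin (n + 1)) :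
    σ.SameCycle z (cut y σ z) := by
  simp only [cut, Perm.mul_apply]
  rcases eq_or_ne (σ z) y with h1 | h1
  · rw [h1, swap_apply_left]
    -- z ↦ σ y, and y = σ z is on the cycle of z
    have : σ.SameCycle z y := h1 ▸ (sameCycle_apply_right.2 (SameCycle.refl σ z))
    exact sameCycle_apply_right.2 this
  rcases eq_or_ne (σ z) (σ y) with h2 | h2
  · rw [h2, swap_apply_right]
    have hzy : z = y := σ.injective h2
    subst hzy
    exact SameCycle.refl σ z
  · rw [swap_apply_of_ne_of_ne h1 h2]
    exact sameCycle_apply_right.2 (SameCycle.refl σ z)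

/-- Iterates of the short-cut stay on the old cycle. [this work] -/
theorem sameCycle_cut_pow_apply (y : Fin (n + 1)) (σ : Perm (Fin (n + 1))) (z : Fin (n + 1)) :
    ∀ j : ℕ, σ.SameCycle z (((cut y σ) ^ j) z)
  | 0 => by simp only [pow_zero, Perm.one_apply]; exact SameCycle.refl σ z
  | j + 1 => by
    rw [pow_succ', Perm.mul_apply]
    exact (sameCycle_cut_pow_apply y σ z j).trans (sameCycle_cut_apply y σ _)

/-- The new cycle of a point is contained in its old cycle. [this work] -/
theorem sameCycle_of_sameCycle_cut {y : Fin (n + 1)} {σ : Perm (Fin (n + 1))} {z b : Fin (n + 1)}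
    (h : (cut y σ).SameCycle z b) : σ.SameCycle z b := by
  obtain ⟨j, -, rfl⟩ := h.exists_pow_eq'
  exact sameCycle_cut_pow_apply y σ z j

/-- **The cycle of `p` loses exactly the deleted successor**: for `σ p ≠ p`, the cycle of `p` in `cut (σ p) σ` is the old cycle minus
`σ p`. [this work] -/
theorem orbit_cut_succ_base {σ : Perm (Fin (n + 1))} {p : Fin (n + 1)} (hp : σ p ≠ p) :
    orbit (cut (σ p) σ) p = (orbit σ p).erase (σ p) := by
  ext b
  simp only [mem_orbit, mem_erase]
  constructor
  · intro h
    refine ⟨?_, sameCycle_of_sameCycle_cut h⟩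
    rintro rfl
    -- `σ p` is a fixed point of the short-cut, so its new cycle is a singleton; but `p ≠ σ p`
    have hfix : cut (σ p) σ (σ p) = σ p := cut_apply_self _ _
    obtain ⟨j, -, hj⟩ := h.symm.exists_pow_eq'
    have : ((cut (σ p) σ) ^ j) (σ p) = σ p := pow_apply_eq_self_of_apply_eq_self hfix j
    exact hp (hj.symm.trans this).symm
  · rintro ⟨hb, h⟩
    exact (sameCycle_cut_of_sameCycle h (by simpa [eq_comm] using hb)).symm

/-- The same, for a general surviving point of that cycle. [this work] -/
theorem orbit_cut_succ_of_sameCycle {σ : Perm (Fin (n + 1))} {p i : Fin (n + 1)} (hi : σ.SameCycle p i) (hne : i ≠ σ p) :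
    orbit (cut (σ p) σ) i = (orbit σ p).erase (σ p) := by
  rcases eq_or_ne (σ p) p with hfp | hfp
  · -- `p` fixed: then `i = p = σ p`, contradicting `i ≠ σ p`
    have hip : i = p := by
      obtain ⟨j, -, hj⟩ := hi.exists_pow_eq'
      rw [← hj, pow_apply_eq_self_of_apply_eq_self hfp j]
    exact (hne (hip.trans hfp.symm)).elim
  · rw [← orbit_cut_succ_base hfp]
    exact orbit_eq_orbit_of_sameCycle (sameCycle_cut_of_sameCycle hi hne)

/-- A σ-stable set contains the cycles of its points. [folklore] -/
theorem orbit_subset_of_stable {σ : Perm (Fin (n + 1))} {S : Finset (Fin (n + 1))} (hS : ∀ x ∈ S, σ x ∈ S)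
    {x : Fin (n + 1)} (hx : x ∈ S) : orbit σ x ⊆ S := by
  intro b hb
  obtain ⟨j, -, rfl⟩ := (mem_orbit.1 hb).exists_pow_eq'
  induction j with
  | zero => simpa using hx
  | succ j ih =>
    rw [pow_succ', Perm.mul_apply]
    exact hS _ (ih (mem_orbit.2 ⟨j, by rw [zpow_natCast]⟩))

/-- The short-cut of a point of a σ-stable set leaves the set stable. [this work] -/
theorem stable_cut {σ : Perm (Fin (n + 1))} {S : Finset (Fin (n + 1))} (hS : ∀ x ∈ S, σ x ∈ S)
    {y : Fin (n + 1)} (hy : y ∈ S) : ∀ x ∈ S, cut y σ x ∈ S := by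
  intro x hx
  simp only [cut, Perm.mul_apply]
  rcases eq_or_ne (σ x) y with h1 | h1
  · rw [h1, swap_apply_left]; exact hS _ hy
  rcases eq_or_ne (σ x) (σ y) with h2 | h2
  · rw [h2, swap_apply_right]; exact hy
  · rw [swap_apply_of_ne_of_ne h1 h2]; exact hS _ hx

/-- Outside the cycle of `y`, the short-cut agrees with `σ`. [this work] -/
theorem cut_apply_of_not_sameCycle {σ : Perm (Fin (n + 1))} {y x : Fin (n + 1)} (h : ¬ σ.SameCycle x y) :
    cut y σ x = σ x := by
  apply cut_apply_of_ne
  · intro h1; exact h (h1 ▸ sameCycle_apply_right.2 (SameCycle.refl σ x))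
  · intro h2; exact h ((σ.injective h2) ▸ SameCycle.refl σ x)

/-- The predecessor of `y` is re-routed to `σ y`; every other point of the cycle of `y` keeps its image. [this work] -/
theorem cut_apply_of_sameCycle_of_ne {σ : Perm (Fin (n + 1))} {y x : Fin (n + 1)} (h1 : σ x ≠ y) (h2 : x ≠ y) :
    cut y σ x = σ x :=
  cut_apply_of_ne h1 (fun h => h2 (σ.injective h))

/-- The predecessor of the deleted point `y` is re-routed to `σ y`. [this work] -/
theorem cut_apply_pred {σ : Perm (Fin (n + 1))} (y : Fin (n + 1)) : cut y σ (σ.symm y) = σ y := by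
  simp [cut, Perm.mul_apply]


/-! ### Variants of the surgery lemmas indexed by the deleted point `y` (with `p := σ⁻¹ y`) -/

/-- Rewriting `cut y σ` in the "delete the successor of `p = σ⁻¹ y`" form. [this work] -/
theorem cut_eq_cut_succ_symm (y : Fin (n + 1)) (σ : Perm (Fin (n + 1))) : cut y σ = cut (σ (σ.symm y)) σ := by
  rw [apply_symm_apply]

/-- The cycle through the deleted point `y` loses exactly `y`. [this work] -/
theorem orbit_cut_of_sameCycle {σ : Perm (Fin (n + 1))} {y i : Fin (n + 1)} (hi : σ.SameCycle y i) (hne : i ≠ y) :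
    orbit (cut y σ) i = (orbit σ y).erase y := by
  have h := @orbit_cut_succ_of_sameCycle n σ (σ.symm y) i (by simpa using hi) (by simpa using hne)
  have ho : orbit σ (σ.symm y) = orbit σ y :=
    orbit_eq_orbit_of_sameCycle (sameCycle_symm_apply_left.2 (SameCycle.refl σ y))
  rw [ho] at h
  simpa using h

/-- Cycles not through `y` are unchanged. [this work] -/
theorem orbit_cut_of_not_sameCycle' {σ : Perm (Fin (n + 1))} {y a : Fin (n + 1)} (ha : ¬ σ.SameCycle a y) :
    orbit (cut y σ) a = orbit σ a := by
  have h := @orbit_cut_of_not_sameCycle n σ (σ.symm y) a (by simpa using ha)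
  simpa using h

/-- A surviving point of the cycle through `y` is still on the cycle of every other surviving point of it. [this work] -/
theorem sameCycle_cut_of_sameCycle' {σ : Perm (Fin (n + 1))} {y i j : Fin (n + 1)} (hi : σ.SameCycle y i) (hj : σ.SameCycle y j)
    (hiy : i ≠ y) (hjy : j ≠ y) : (cut y σ).SameCycle i j := by
  have h1 := @sameCycle_cut_of_sameCycle n σ (σ.symm y) i (by simpa using hi) (by simpa using hiy)
  have h2 := @sameCycle_cut_of_sameCycle n σ (σ.symm y) j (by simpa using hj) (by simpa using hjy)
  simp only [apply_symm_apply] at h1 h2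
  exact h1.trans h2.symm

/-- Strict decrease of the ground set when a cycle through one of its points is removed. [folklore] -/
theorem card_sdiff_lt_of_mem {S t : Finset (Fin (n + 1))} {x : Fin (n + 1)} (hx : x ∈ S) (hxt : x ∈ t) :
    (S \ t).card < S.card := by
  apply card_lt_card
  refine ⟨sdiff_subset, fun h => ?_⟩
  have := h hx
  rw [mem_sdiff] at this
  exact this.2 hxt

/-! ### Hereditarily bad cycles of `M` ("all proper prefix sets are non-members") -/

/-- `HBk 𝒰 M k σ` (fuel `k`): deleting the predecessor of `M` repeatedly, every intermediate cycle of `M` is a non-member of `𝒰`, until `M` is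
fixed.  With fuel `= #(cycle of M)` this is RULE T's T2-condition "all proper prefix sets `{M, σM, …, σʲM}` of the cycle of `M` are
non-members". [this work] -/
def HBk (𝒰 : Finset (Finset (Fin (n + 1)))) (M : Fin (n + 1)) : ℕ → Perm (Fin (n + 1)) → Prop
  | 0, _ => True
  | k + 1, σ => σ M = M ∨ (orbit (cut (σ.symm M) σ) M ∉ 𝒰 ∧ HBk 𝒰 M k (cut (σ.symm M) σ))

/-- The T2-condition of RULE T: all proper prefix sets of the cycle of `M` are non-members. [this work] -/
def HB (𝒰 : Finset (Finset (Fin (n + 1)))) (M : Fin (n + 1)) (σ : Perm (Fin (n + 1))) : Prop :=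
  HBk 𝒰 M (orbit σ M).card σ

/-- A cycle is nonempty. [folklore] -/
theorem card_orbit_pos (σ : Perm (Fin (n + 1))) (M : Fin (n + 1)) : 0 < (orbit σ M).card :=
  card_pos.2 ⟨M, self_mem_orbit σ M⟩

/-- Deleting the predecessor of a non-fixed `M` shrinks its cycle by one. [this work] -/
theorem orbit_cut_pred {σ : Perm (Fin (n + 1))} {M : Fin (n + 1)} (hM : σ M ≠ M) :
    orbit (cut (σ.symm M) σ) M = (orbit σ M).erase (σ.symm M) := by
  have h1 : σ.SameCycle (σ.symm M) M := sameCycle_symm_apply_left.2 (SameCycle.refl σ M)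
  have hne : M ≠ σ.symm M := fun h => hM (by simpa using congrArg σ h)
  rw [orbit_cut_of_sameCycle h1 hne, orbit_eq_orbit_of_sameCycle h1]

/-- … so its size drops by exactly one. [this work] -/
theorem card_orbit_cut_pred {σ : Perm (Fin (n + 1))} {M : Fin (n + 1)} (hM : σ M ≠ M) :
    (orbit (cut (σ.symm M) σ) M).card + 1 = (orbit σ M).card := by
  rw [orbit_cut_pred hM, card_erase_add_one]
  exact mem_orbit.2 ((sameCycle_symm_apply_right (f := σ)).2 (SameCycle.refl σ M))

/-- A fixed `M` is hereditarily bad (vacuously). [this work] -/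
theorem HB_of_apply_eq {𝒰 : Finset (Finset (Fin (n + 1)))} {M : Fin (n + 1)} {σ : Perm (Fin (n + 1))} (h : σ M = M) :
    HB 𝒰 M σ := by
  unfold HB
  obtain ⟨k, hk⟩ : ∃ k, (orbit σ M).card = k + 1 := Nat.exists_eq_add_one_of_ne_zero (card_orbit_pos σ M).ne'
  rw [hk]
  exact Or.inl h

/-- Unfolding `HB` at a non-fixed `M`. [this work] -/
theorem HB_iff_of_apply_ne {𝒰 : Finset (Finset (Fin (n + 1)))} {M : Fin (n + 1)} {σ : Perm (Fin (n + 1))} (h : σ M ≠ M) :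
    HB 𝒰 M σ ↔ orbit (cut (σ.symm M) σ) M ∉ 𝒰 ∧ HB 𝒰 M (cut (σ.symm M) σ) := by
  unfold HB
  rw [← card_orbit_cut_pred h]
  simp only [HBk, h, false_or]

/-- Iterates from `M` of two permutations agreeing on the cycle of `M` coincide. [folklore] -/
theorem pow_apply_eq_of_agree {σ σ' : Perm (Fin (n + 1))} {M : Fin (n + 1)} (h : ∀ x ∈ orbit σ M, σ' x = σ x) :
    ∀ j : ℕ, (σ' ^ j) M = (σ ^ j) M
  | 0 => by simp
  | j + 1 => by
    rw [pow_succ', Perm.mul_apply, pow_apply_eq_of_agree h j, pow_succ', Perm.mul_apply]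
    exact h _ (mem_orbit.2 ⟨j, by rw [zpow_natCast]⟩)

/-- … hence the two cycles of `M` coincide. [folklore] -/
theorem orbit_eq_of_agree {σ σ' : Perm (Fin (n + 1))} {M : Fin (n + 1)} (h : ∀ x ∈ orbit σ M, σ' x = σ x) :
    orbit σ' M = orbit σ M := by
  ext b
  simp only [mem_orbit]
  constructor
  · intro hb
    obtain ⟨j, -, rfl⟩ := hb.exists_pow_eq'
    exact ⟨j, by rw [zpow_natCast, pow_apply_eq_of_agree h j]⟩
  · intro hb
    obtain ⟨j, -, rfl⟩ := hb.exists_pow_eq'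
    exact ⟨j, by rw [zpow_natCast, pow_apply_eq_of_agree h j]⟩

/-- … and the predecessors of `M` coincide. [folklore] -/
theorem symm_apply_eq_of_agree {σ σ' : Perm (Fin (n + 1))} {M : Fin (n + 1)} (h : ∀ x ∈ orbit σ M, σ' x = σ x) :
    σ'.symm M = σ.symm M := by
  apply σ'.injective
  rw [apply_symm_apply, h _ (mem_orbit.2 ((sameCycle_symm_apply_right (f := σ)).2 (SameCycle.refl σ M))),
    apply_symm_apply]

/-- `HB` depends on `σ` only through its restriction to the cycle of `M`. [this work] -/
theorem HB_congr {𝒰 : Finset (Finset (Fin (n + 1)))} {M : Fin (n + 1)} :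
    ∀ (k : ℕ) {σ σ' : Perm (Fin (n + 1))}, (orbit σ M).card = k → (∀ x ∈ orbit σ M, σ' x = σ x) →
      (HB 𝒰 M σ' ↔ HB 𝒰 M σ) := by
  intro k
  induction k using Nat.strong_induction_on with
  | _ k ih =>
    intro σ σ' hk h
    have hM' : σ' M = σ M := h M (self_mem_orbit σ M)
    by_cases hfix : σ M = M
    · exact ⟨fun _ => HB_of_apply_eq hfix, fun _ => HB_of_apply_eq (hM'.trans hfix)⟩
    · have hfix' : σ' M ≠ M := fun e => hfix (hM'.symm.trans e)
      rw [HB_iff_of_apply_ne hfix, HB_iff_of_apply_ne hfix', symm_apply_eq_of_agree h]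
      -- the two short-cuts agree on the (common) new cycle of `M`
      have hsub : orbit (cut (σ.symm M) σ) M ⊆ orbit σ M := by
        rw [orbit_cut_pred hfix]; exact erase_subset _ _
      have hagree : ∀ x ∈ orbit (cut (σ.symm M) σ) M, cut (σ.symm M) σ' x = cut (σ.symm M) σ x := by
        intro x hx
        have hxo := hsub hx
        simp only [cut, Perm.mul_apply]
        rw [h x hxo, h _ (mem_orbit.2 ((sameCycle_symm_apply_right (f := σ)).2 (SameCycle.refl σ M)))]
      rw [orbit_eq_of_agree hagree]
      have hlt : (orbit (cut (σ.symm M) σ) M).card < k := by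
        have := card_orbit_cut_pred (M := M) hfix; omega
      rw [ih _ hlt rfl hagree]

/-! ### Uncovered points relative to a ground set -/

/-- `p` is an uncovered point of the ground set `S`: it lies in `S` and in no member of `𝒰` inside `S`. [this work] -/
def UncovIn (𝒰 : Finset (Finset (Fin (n + 1)))) (S : Finset (Fin (n + 1))) (p : Fin (n + 1)) : Prop :=
  p ∈ S ∧ ∀ A ∈ 𝒰, A ⊆ S → p ∉ A

/-- A TOPLESS ground set of a union-closed family has an uncovered point. [this work] -/
theorem exists_uncovIn {𝒰 : Finset (Finset (Fin (n + 1)))} (hU : ∀ A ∈ 𝒰, ∀ B ∈ 𝒰, A ∪ B ∈ 𝒰)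
    {S : Finset (Fin (n + 1))} (hS : S.Nonempty) (htop : S ∉ 𝒰) : ∃ p, UncovIn 𝒰 S p := by
  by_contra hcon
  have hcov : ∀ q ∈ S, ∃ A ∈ 𝒰, A ⊆ S ∧ q ∈ A := by
    intro q hq
    by_contra hq'
    exact hcon ⟨q, hq, fun A hA hAS hqA => hq' ⟨A, hA, hAS, hqA⟩⟩
  choose! A hA hAS hpA using hcov
  apply htop
  have hcovS : S.biUnion A = S := by
    ext q
    simp only [mem_biUnion]
    exact ⟨fun ⟨x, hx, hq⟩ => hAS x hx hq, fun hq => ⟨q, hq, hpA q hq⟩⟩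
  rw [← hcovS]
  exact biUnion_mem_of_unionClosed hU S hS A hA

/-- A canonical uncovered point of `S` (junk value `0` if there is none). [this work] -/
def uncov (𝒰 : Finset (Finset (Fin (n + 1)))) (S : Finset (Fin (n + 1))) : Fin (n + 1) :=
  if h : ∃ p, UncovIn 𝒰 S p then Classical.choose h else 0

/-- The canonical uncovered point is uncovered whenever some point is. [this work] -/
theorem uncovIn_uncov {𝒰 : Finset (Finset (Fin (n + 1)))} {S : Finset (Fin (n + 1))} (h : ∃ p, UncovIn 𝒰 S p) :
    UncovIn 𝒰 S (uncov 𝒰 S) := by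
  unfold uncov
  rw [dif_pos h]
  exact Classical.choose_spec h

/-! ### RULE T: the encoder and its decoder -/

/-- **RULE T** on the ground set `S` (a union of cycles of `σ`): the point of `S` to delete.
 (a) `S ∉ 𝒰`: the successor of the canonical uncovered point of `S`;
 (b) `S ∈ 𝒰`, `M = max S`: if the cycle of `M` is hereditarily bad (in particular if `M` is fixed) the predecessor `σ⁻¹ M` of `M`
     (`= M` when `M` is fixed); otherwise recurse on `S` minus the cycle of `M`. [this work] -/
def enc (𝒰 : Finset (Finset (Fin (n + 1)))) (σ : Perm (Fin (n + 1))) (S : Finset (Fin (n + 1))) : Fin (n + 1) :=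
  if hS : S.Nonempty then
    if S ∉ 𝒰 then σ (uncov 𝒰 S)
    else if HB 𝒰 (S.max' hS) σ then σ.symm (S.max' hS)
    else enc 𝒰 σ (S \ orbit σ (S.max' hS))
  else 0
termination_by S.card
decreasing_by exact card_sdiff_lt_of_mem (max'_mem S hS) (self_mem_orbit σ _)

/-- The DECODER of RULE T: from the deleted point `y` and the short-cut permutation `σ'`, rebuild `σ`. [this work] -/
def dec (𝒰 : Finset (Finset (Fin (n + 1)))) (y : Fin (n + 1)) (σ' : Perm (Fin (n + 1))) (S : Finset (Fin (n + 1))) :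
    Perm (Fin (n + 1)) :=
  if hS : S.Nonempty then
    if S ∉ 𝒰 then swap y (σ' (uncov 𝒰 S)) * σ'
    else if y = S.max' hS ∨ (orbit σ' (S.max' hS) ∉ 𝒰 ∧ HB 𝒰 (S.max' hS) σ') then swap y (S.max' hS) * σ'
    else dec 𝒰 y σ' (S \ orbit σ' (S.max' hS))
  else σ'
termination_by S.card
decreasing_by exact card_sdiff_lt_of_mem (max'_mem S hS) (self_mem_orbit σ' _)

/-- Unfolding `enc`, case (a) (topless ground set). [this work] -/
theorem enc_of_not_mem {𝒰 : Finset (Finset (Fin (n + 1)))} {σ : Perm (Fin (n + 1))} {S : Finset (Fin (n + 1))}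
    (hS : S.Nonempty) (h : S ∉ 𝒰) : enc 𝒰 σ S = σ (uncov 𝒰 S) := by
  rw [enc, dif_pos hS, if_pos h]

/-- Unfolding `enc`, case (b) with a hereditarily bad cycle of the maximum (T1/T2). [this work] -/
theorem enc_of_HB {𝒰 : Finset (Finset (Fin (n + 1)))} {σ : Perm (Fin (n + 1))} {S : Finset (Fin (n + 1))}
    (hS : S.Nonempty) (h : ¬ S ∉ 𝒰) (hHB : HB 𝒰 (S.max' hS) σ) : enc 𝒰 σ S = σ.symm (S.max' hS) := by
  rw [enc, dif_pos hS, if_neg h, if_pos hHB]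

/-- Unfolding `enc`, case (b) otherwise (T3: recurse on the complement of the cycle of the maximum). [this work] -/
theorem enc_of_not_HB {𝒰 : Finset (Finset (Fin (n + 1)))} {σ : Perm (Fin (n + 1))} {S : Finset (Fin (n + 1))}
    (hS : S.Nonempty) (h : ¬ S ∉ 𝒰) (hHB : ¬ HB 𝒰 (S.max' hS) σ) :
    enc 𝒰 σ S = enc 𝒰 σ (S \ orbit σ (S.max' hS)) := by
  rw [enc, dif_pos hS, if_neg h, if_neg hHB]

/-- Unfolding `dec`, case (a). [this work] -/
theorem dec_of_not_mem {𝒰 : Finset (Finset (Fin (n + 1)))} {y : Fin (n + 1)} {σ' : Perm (Fin (n + 1))} {S : Finset (Fin (n + 1))}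
    (hS : S.Nonempty) (h : S ∉ 𝒰) : dec 𝒰 y σ' S = swap y (σ' (uncov 𝒰 S)) * σ' := by
  rw [dec, dif_pos hS, if_pos h]

/-- Unfolding `dec`, case (b) when the T1/T2 test fires. [this work] -/
theorem dec_of_test {𝒰 : Finset (Finset (Fin (n + 1)))} {y : Fin (n + 1)} {σ' : Perm (Fin (n + 1))} {S : Finset (Fin (n + 1))}
    (hS : S.Nonempty) (h : ¬ S ∉ 𝒰) (ht : y = S.max' hS ∨ (orbit σ' (S.max' hS) ∉ 𝒰 ∧ HB 𝒰 (S.max' hS) σ')) :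
    dec 𝒰 y σ' S = swap y (S.max' hS) * σ' := by
  rw [dec, dif_pos hS, if_neg h, if_pos ht]

/-- Unfolding `dec`, case (b) when the T1/T2 test fails (recurse). [this work] -/
theorem dec_of_not_test {𝒰 : Finset (Finset (Fin (n + 1)))} {y : Fin (n + 1)} {σ' : Perm (Fin (n + 1))} {S : Finset (Fin (n + 1))}
    (hS : S.Nonempty) (h : ¬ S ∉ 𝒰) (ht : ¬ (y = S.max' hS ∨ (orbit σ' (S.max' hS) ∉ 𝒰 ∧ HB 𝒰 (S.max' hS) σ'))) :
    dec 𝒰 y σ' S = dec 𝒰 y σ' (S \ orbit σ' (S.max' hS)) := by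
  rw [dec, dif_pos hS, if_neg h, if_neg ht]


end RemovalInjection

end Summit.CriticalPhenomena.PercolationContinuityZ3.Theorems
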